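import Summits.KontsevichZagierPeriods.Zeta5Search.Barrier.ConeGammaCritBox
import Literature.Analysis.ValidatedNumerics.AffineArithmeticInv

/-!
# ζ(5) search — BARRIER: THE FAR CRITICAL POINT THROUGH INFINITY — the computable checker (far root of BZ's
# resolvent cubic by a sign change in the chart `z = 1/Y`; critical values on wider boxes and across the
# degenerate-resultant stratum)

HONEST FRAMING (cell `pub-zeta5`): systematic search; no irrationality claim unless kernel-certified. Computable
integer / `EPoly` / `AForm` DATA and FUNCTIONS only (none Prop-valued, no named fact); the soundness theorems are in
`ConeGammaCritFarSound` / `ConeGammaCritFarCert`. Objects: BZ's §5 critical system in the shifted symmetric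
coordinates `X = x − s₆`, `Y = y − s₆` (`ConeGammaRates`, `F1R_aOfS`/`F2R_aOfS`), P2 g23's resolvent cubic `C(Y)`
(`ConeGammaCritCubic`, product form), cert-2 g37's box conventions and near-point certificates (`ConeGammaCritBox`:
`tPoly`, `RootData`, `rootCheck`, `valueAF`, `argsFar`); MODEL objects under BZ (28)+(30). Nothing about any γ of
record, C2 (OPEN), S-E or `ζ(5)`. Theory seat cert-2 g38 (item «THE FAR CRITICAL POINT THROUGH INFINITY», INBOX plan
2026-08-27).

THE FAR POINT. The middle critical value `C₀` belongs to the critical point that escapes to `Y = ∞` on the stratum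
`{a₃ = 0}` (`a₃` = leading coefficient of `C`), with `X` and the value finite and continuous there. This checker does
NOT follow the moving point: it LOCATES the far root of `C` by a sign change of `z³·C(1/z)` between two rationals
`z⁻ < z⁺` (of either sign; `cubicAtPoly` = `(Q·y_D)⁷·C(Y)` at the rational `Y = 1/z∓`, exact in the 7 box noise
variables), computes `X = (n₂ + n₁z + n₀z²)/((s₆−s₀) + q₁z + q₀z²)` (the identity `X·Q(Y) = −Y·Q(Y) + (s₆−s₀)·P(Y)`
read at `Y = 1/z`; affine arithmetic with `AForm.inv`) and encloses the far value with g37's `argsFar`/`logSum` over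
box × z-piece (`farValue`, hull over `pieces` sub-intervals of `[z⁻, z⁺]`). The two near points are g37's `rootCheck`
certificates as they stand. DATA CONVENTIONS = `ConeGammaCritBox` (box `(D, lo, hi)`, `Q = 2·D·T`, noise `ε₁..ε₇`,
`ε₉` = the z-coordinate of the far piece, affine scale `SC = 2⁶⁰`).
-/

namespace Summit.KontsevichZagierPeriods.Zeta5Search.Barrier.ConeGamma

namespace CritFar

open Literature.Analysis.ValidatedNumerics (AForm)
open Literature.Analysis.ValidatedNumerics.AForm
open LemmaFBox (SC)
open CritBox

/-! ### Data -/

/-- Certificate data of the FAR root: the z-interval `[zlo/zden, zhi/zden]` (`z = 1/Y`, `Y = y − s₆`; the endpoints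
are non-zero, the interval may contain `0`) and the number of pieces for the value hull. -/
structure FarData where
  /-- scaled left end of the z-interval -/
  zlo : ℤ
  /-- scaled right end of the z-interval -/
  zhi : ℤ
  /-- the scale of the z-interval -/
  zden : ℕ
  /-- number of sub-intervals (pieces) of the z-interval for the value enclosure (`≥ 1`) -/
  pieces : ℕ
  /-- claimed lower end of the far value enclosure (scale `SC`), checked on every piece -/
  vlo : ℤ
  /-- claimed upper end of the far value enclosure (scale `SC`) -/
  vhi : ℤ
  deriving DecidableEq, Repr

/-! ### The resolvent cubic at a rational point, exactly (`EPoly`, value = `(Q·y_D)⁷·C(Y)`) -/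

section Cubic
/- `t i` = `Q·t_i`. With `y := Q·y_N` (a constant) every linear factor `Y ± c` of P2 g23's product form is carried as
`(Q·y_D)·(Y ± c) = y ± y_D·(Q·c)`. -/

/-- `(Q·y_D)·(Y + t_j)`. -/
def facP (t : Fin 8 → EPoly) (Q : ℕ) (yN : ℤ) (yD : ℕ) (j : Fin 8) : EPoly :=
  EPoly.merge (EPoly.const ((Q : ℤ) * yN)) (EPoly.smul (yD : ℤ) (t j))

/-- `(Q·y_D)·(Y − t_j)`. -/
def facM (t : Fin 8 → EPoly) (Q : ℕ) (yN : ℤ) (yD : ℕ) (j : Fin 8) : EPoly :=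
  EPoly.merge (EPoly.const ((Q : ℤ) * yN)) (EPoly.smul (-(yD : ℤ)) (t j))

/-- `(Q·y_D)·(c − Y)` for `Q·c = p`. -/
def facR (Q : ℕ) (yN : ℤ) (yD : ℕ) (p : EPoly) : EPoly :=
  EPoly.merge (EPoly.smul (yD : ℤ) p) (EPoly.const (-((Q : ℤ) * yN)))

variable (t : Fin 8 → EPoly) (Q : ℕ) (yN : ℤ) (yD : ℕ)

/-- **`(Q·y_D)⁷ · C(Y)` at `Y = y_N/y_D`**, `C` = P2 g23's resolvent cubic in its PRODUCT form
`−E(Y)·(σ′−Y)²·(s₀−Y) + B(Y)·(σ′−Y)·P(Y) + (Y − s₀ + e₁)·P(Y)²` (`E = Π_{j∈{3,4,6,5}}(Y+s_j)`,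
`P = (Y−s₁)(Y−s₂)(Y−s₇)`, `B = 2Y³ − 2(s₀−e₁)Y² − (s₀e₁−e₂)Y − (s₀e₂−e₃)`, `e_k` the elementary symmetric functions
of `s₃, s₄, s₆, s₅`), every factor scaled to an integer polynomial in the noise variables. Only its SIGN is used. -/
def cubicAtPoly : EPoly :=
  let y : EPoly := EPoly.const ((Q : ℤ) * yN)
  let d : ℤ := yD
  let E := prodPoly [facP t Q yN yD 3, facP t Q yN yD 4, facP t Q yN yD 6, facP t Q yN yD 5]
  let W := facR Q yN yD (EPoly.merge (EPoly.merge (t 1) (t 2)) (t 7))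
  let S0 := facR Q yN yD (t 0)
  let P := prodPoly [facM t Q yN yD 1, facM t Q yN yD 2, facM t Q yN yD 7]
  let e1 := EPoly.merge (EPoly.merge (t 3) (t 4)) (EPoly.merge (t 6) (t 5))
  let e2 := EPoly.merge (EPoly.merge (EPoly.merge (EPoly.mul (t 3) (t 4)) (EPoly.mul (t 3) (t 6)))
      (EPoly.merge (EPoly.mul (t 3) (t 5)) (EPoly.mul (t 4) (t 6))))
    (EPoly.merge (EPoly.mul (t 4) (t 5)) (EPoly.mul (t 6) (t 5)))
  let e3 := EPoly.merge (EPoly.merge (EPoly.mul (EPoly.mul (t 3) (t 4)) (t 6)) (EPoly.mul (EPoly.mul (t 3) (t 4)) (t 5)))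
    (EPoly.merge (EPoly.mul (EPoly.mul (t 3) (t 6)) (t 5)) (EPoly.mul (EPoly.mul (t 4) (t 6)) (t 5)))
  -- `(Q y_D)³·B(Y) = 2y³ − 2·y_D·(Qs₀ − Qe₁)·y² − y_D²·(Qs₀·Qe₁ − Q²e₂)·y − y_D³·(Qs₀·Q²e₂ − Q³e₃)`
  let B := EPoly.merge
    (EPoly.merge (EPoly.smul 2 (EPoly.mul (EPoly.mul y y) y))
      (EPoly.smul (-2 * d) (EPoly.mul (EPoly.merge (t 0) (EPoly.smul (-1) e1)) (EPoly.mul y y))))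
    (EPoly.merge (EPoly.smul (-(d * d)) (EPoly.mul (EPoly.merge (EPoly.mul (t 0) e1) (EPoly.smul (-1) e2)) y))
      (EPoly.smul (-(d * d * d)) (EPoly.merge (EPoly.mul (t 0) e2) (EPoly.smul (-1) e3))))
  -- `(Q y_D)·(Y − s₀ + e₁) = y + y_D·(Qe₁ − Qs₀)`
  let L := EPoly.merge y (EPoly.smul d (EPoly.merge e1 (EPoly.smul (-1) (t 0))))
  EPoly.merge (EPoly.smul (-1) (EPoly.mul (EPoly.mul E (EPoly.mul W W)) S0))
    (EPoly.merge (EPoly.mul (EPoly.mul B W) P) (EPoly.mul L (EPoly.mul P P)))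

end Cubic

/-- The certified SIGN of an integer polynomial on the noise cube from its crude bounds: `1` if `lower > 0`, `-1` if
`upper < 0`, else `0` (undecided). -/
def signOfBounds (p : EPoly) : ℤ := if 0 < EPoly.lower p then 1 else if EPoly.upper p < 0 then -1 else 0

/-- The certified SIGN (`1`, `-1`, or `0` = undecided) of `z³·C(1/z)` at the endpoint `z = zN/zden` (`zN ≠ 0`):
`sign(C(Y))·sign(z)` with `Y = zden/zN = (zden·sign zN)/|zN|`, the sign of `C(Y)` read off the crude bounds of
`cubicAtPoly`. -/
def endSign (D T : ℕ) (lo hi : List ℕ) (zN : ℤ) (zden : ℕ) : ℤ :=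
  signOfBounds (cubicAtPoly (tPoly D T lo hi) (2 * D * T) ((zden : ℤ) * Int.sign zN) zN.natAbs) * Int.sign zN

/-! ### Affine forms: the z-coordinate of a piece, `X = N(z)/Q(z)`, the far value -/

/-- The z-coordinate of piece `j` of `m` of `[zlo, zhi]/zden` as an affine form on `ε₉`:
`z = (zlo + (2j+1)·h + h·ε₉)/zden`, `h = (zhi − zlo)/(2m)`; carried with the common denominator `2m·zden`:
`(2m·zlo + (2j+1)(zhi−zlo) + (zhi−zlo)·ε₉)/(2m·zden)` = g37's `coordAF` with centre/width data. -/
def zPieceAF (fd : FarData) (j : ℕ) : AForm :=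
  coordAF (2 * (fd.pieces : ℤ) * fd.zlo + (2 * (j : ℤ) + 1) * (fd.zhi - fd.zlo)) [0, 0, 0, 0, 0, 0, 0]
    (fd.zhi - fd.zlo).toNat 9 (2 * fd.pieces * fd.zden)

section XZ
variable (t : Fin 8 → AForm) (Z : AForm)

/-- Numerator and denominator of **`X = (n₂ + n₁z + n₀z²)/((s₆−s₀) + q₁z + q₀z²)`** at the far point, with
`σ′ = s₁+s₂+s₇`, `e₂′ = s₁s₂+s₁s₇+s₂s₇`, `e₃′ = s₁s₂s₇`, `n₂ = s₀s₆ + e₂′`, `n₁ = −s₀s₆σ′ − e₃′ + (s₆−s₀)e₂′`,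
`n₀ = −(s₆−s₀)e₃′`, `q₁ = σ′s₀ − s₆σ′ − s₆s₀ − e₂′`, `q₀ = s₀s₆σ′ + e₃′` (from `X·Q(Y) = −Y·Q(Y) + (s₆−s₀)P(Y)`, whose
`Y³` terms cancel, divided by `Y²`). -/
def xNumDen : AForm × AForm :=
  let sp := add (add (t 1) (t 2)) (t 7)
  let e2 := add (add (mul SC (t 1) (t 2)) (mul SC (t 1) (t 7))) (mul SC (t 2) (t 7))
  let e3 := mul SC (mul SC (t 1) (t 2)) (t 7)
  let d := sub (t 6) (t 0)
  let s06 := mul SC (t 0) (t 6)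
  let n2 := add s06 e2
  let n1 := add (sub (neg (mul SC s06 sp)) e3) (mul SC d e2)
  let n0 := neg (mul SC d e3)
  let q1 := sub (sub (sub (mul SC sp (t 0)) (mul SC (t 6) sp)) s06) e2
  let q0 := add (mul SC s06 sp) e3
  let Z2 := mul SC Z Z
  (add (add n2 (mul SC n1 Z)) (mul SC n0 Z2), add (add d (mul SC q1 Z)) (mul SC q0 Z2))

/-- `X` at the far point as an affine form: `X = −N·(1/(−Q))` (the denominator is NEGATIVE near `z = 0` since
`s₆ < s₀`; `none` if `−Q` is not certified positive). -/
def xhatAF : Option AForm :=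
  match inv SC (neg (xNumDen t Z).2) with
  | some I => some (neg (mul SC (xNumDen t Z).1 I))
  | none => none

/-- The far critical value over box × piece as an affine form: g37's `valueAF` in the far chart at `(X(z), z)`. -/
def farValueAF : Option AForm :=
  match xhatAF t Z with
  | some X => valueAF t X Z true
  | none => none

end XZ

/-- Hull of the value enclosures over the pieces `j = 0..m−1` (`none` if some piece fails) — a convenience for
`#eval` when preparing certificate data (`vlo`, `vhi`); the certified test is `pieceOK`. -/
def farValueHull (D : ℕ) (lo hi : List ℕ) (fd : FarData) : ℕ → Option (ℤ × ℤ)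
  | 0 => none
  | 1 => match farValueAF (tAF D lo hi) (zPieceAF fd 0) with
    | some G => some (AForm.lo G, AForm.hi G)
    | none => none
  | m + 1 => match farValueHull D lo hi fd m, farValueAF (tAF D lo hi) (zPieceAF fd m) with
    | some (l, h), some G => some (min l (AForm.lo G), max h (AForm.hi G))
    | _, _ => none

/-- An optional value form lies inside the claimed `[vlo, vhi]` (and exists). -/
def encOK (vlo vhi : ℤ) : Option AForm → Bool
  | some G => decide (vlo ≤ AForm.lo G ∧ AForm.hi G ≤ vhi)
  | none => false

/-- Piece `j` evaluates and its value enclosure lies inside the claimed `[vlo, vhi]`. -/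
def pieceOK (D : ℕ) (lo hi : List ℕ) (fd : FarData) (j : ℕ) : Bool :=
  encOK fd.vlo fd.vhi (farValueAF (tAF D lo hi) (zPieceAF fd j))

/-- **The far-root certificate**: the endpoints are non-zero and ordered, the certified signs of `z³C(1/z)` at
`z⁻`, `z⁺` are OPPOSITE, and every one of the `pieces` sub-intervals certifies the claimed value enclosure; returns
`[vlo, vhi]` (scale `SC`), an enclosure of the far critical value. -/
def farCheck (D T : ℕ) (lo hi : List ℕ) (fd : FarData) : Option (ℤ × ℤ) :=
  if (0 < fd.zden ∧ fd.zlo < fd.zhi ∧ fd.zlo ≠ 0 ∧ fd.zhi ≠ 0 ∧ 0 < fd.pieces ∧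
      endSign D T lo hi fd.zlo fd.zden * endSign D T lo hi fd.zhi fd.zden = -1) ∧
      (List.range fd.pieces).all (pieceOK D lo hi fd) = true then
    some (fd.vlo, fd.vhi)
  else none

/-- `max(|zlo|, |zhi|)`: the largest `|z|·zden` of the interval. -/
def zAbsMax (fd : FarData) : ℕ := max fd.zlo.natAbs fd.zhi.natAbs

/-- SEPARATION of a near root from the far one: `|Y_near| < 1/|z|` for every `z` of the far interval, i.e.
`(|cv| + Σ|av_j| + wv)·max|z∓| < Q·zden` (`Q·Y_near = cv + Σ av_j ε_j + wv·η`). -/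
def nearSep (T D : ℕ) (rd : RootData) (fd : FarData) : Bool :=
  decide ((rd.cv.natAbs + absSum rd.av + rd.wv) * zAbsMax fd < 2 * D * T * fd.zden)

/-- **The checker.** Two NEAR certificates of g37 (`rootCheck`, near chart) and the FAR certificate, the `C₁`-point's
value enclosure ABOVE the other two (`h₀ < l₂`, `h₁ < l₂`; the order of the `λ₁`- and far values is NOT needed), the
near/far root separation `|Y_near|·|z| < 1`, and the claimed bounds per unit `s₀`: `C₁ ≤ c1hi/den`,
`c0lo/den ≤ C₀ ≤ c0hi/den` (`C₀ = max(λ₁-value, far value) ≥` the far value's lower end). -/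
def critFarCheck (D T : ℕ) (lo hi : List ℕ) (r0 r2 : RootData) (fd : FarData) (c0lo c0hi c1hi : ℤ) (den : ℕ) :
    Bool :=
  match rootCheck D T lo hi r0, farCheck D T lo hi fd, rootCheck D T lo hi r2 with
  | some (_, h0), some (l1, h1), some (l2, h2) =>
      boxOKc D lo hi && nearSep T D r0 fd && nearSep T D r2 fd &&
        decide (0 < T ∧ 0 < den ∧ r0.far = false ∧ r2.far = false ∧ r0.av.length = 7 ∧ r2.av.length = 7 ∧
          h0 < l2 ∧ h1 < l2 ∧ h2 * (den : ℤ) ≤ c1hi * (SC : ℤ) ∧ c0lo * (SC : ℤ) ≤ l1 * (den : ℤ) ∧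
          max h0 h1 * (den : ℤ) ≤ c0hi * (SC : ℤ))
  | _, _, _ => false

end CritFar

end Summit.KontsevichZagierPeriods.Zeta5Search.Barrier.ConeGamma
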